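import Literature.MathematicalPhysics.QuantumLattice.FinDimSpectrumClusterGapProofs
import Literature.MathematicalPhysics.QuantumLattice.LTQOFrustrationFreeProofs
import HarnessLib

/-!
# The final argument of the Michalakis–Zwolak stability proof (abstract, finite-dimensional)

Top-down layer of the formalisation of the Michalakis–Zwolak stability theorem (hubbard.S19,
`Literature.MathematicalPhysics.QuantumLattice.michalakis_zwolak`). This file proves §7 ("Final
Argument") of Michalakis–Zwolak, CMP **322** (2013) 277 = arXiv:1109.1588, pp. 15–16, as an
abstract theorem about Hermitian matrices, *taking the analytic package of §5–§6 as an explicit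
hypothesis* (an implication, quantified over the coupling `s ∈ [0, 1]`):

* the unperturbed `H₀ ≥ 0` has an `m`-dimensional kernel `K = ker H₀`, `m ≥ 1`, and the gap form
  bound `γ‖x‖² ≤ ⟨x, H₀ x⟩` on `Kᗮ` (an exactly `m`-fold degenerate frustration-free ground state
  with gap `γ`);
* **analytic core** (the content of MZ13 Proposition 1, Proposition 2 and Lemma 3, i.e. the
  spectral flow `U(s)`, the relative form bound and the LTQO smallness of `Δ_s`): for every
  `s ∈ [0, 1]` such that all `H_t = H₀ + tV`, `t ∈ [0, s]`, have `m` low-lying eigenvalues in a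
  window of width `≤ ω₀` with a gap `γ/2` above it, there are a unitary `U`, matrices `W`, `Δ` and
  an energy `e` with `U⋆ H_s U = H₀ + W + Δ + e·1`, `⟨x, W x⟩ ≥ −β ⟨x, H₀ x⟩`, `W` vanishing on
  `K`, `Δ K ⊆ K` and `‖Δ‖ ≤ δ` (MZ13 p. 15: "`U†(s)(H₀ + sV)U(s) = H₀ + W_s + Δ_s + E_s·𝟙`, where
  … `|⟨ψ|W_s|ψ⟩| ≤ c·J ⟨ψ|H₀|ψ⟩` … and the norm of `Δ_s` decays rapidly in `L`");
* conclusion: if `β ≤ 1/3`, `48 δ ≤ γ` and `2δ < ω₀`, then `H₀ + V` has exactly `m` eigenvalues in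
  a window of width `2δ` above its ground energy and a gap `≥ γ/2` above the window,
  `(H₀ + V).HasClusterGap m (2δ) (γ/2)` (`hasClusterGap_of_stabilityCore`).

The proof is the bootstrap of MZ13 §7 (after Bravyi–Hastings–Michalakis 2010, §7), organised
on a finite grid `s_k = k/N` instead of by contradiction with continuity: at a grid point where
the analytic package is available, the block form bounds give the cluster gap
`(2δ, (1 − β)γ − 4δ)` (`hasClusterGap_of_conj_decomposition`, from
`hasClusterGap_of_invariant_forms'` of `FinDimSpectrumClusterGapProofs` applied to the rotated
subspace `U K`); Weyl's perturbation bound (`sepCount_of_norm_sub_le`) carries a cluster gap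
`(w, g)` of `A` over to `(ω, g − 2τ)`, `ω ≤ w + 2τ`, for every `B` with `‖A − B‖ ≤ τ`
(`exists_hasClusterGap_of_norm_sub_le`), which covers the interval up to the next grid point
once `τ = ‖V‖/N ≤ min(γ/24, (ω₀ − 2δ)/2)`; induction on `k` reaches `s = 1`.

No definitions and no named facts are introduced (theorems only); the analytic package is a
hypothesis of the final theorem, to be discharged by the spectral-flow layers.
-/

noncomputable section

open Matrix Finset Module
open scoped InnerProductSpace ComplexOrder Matrix.Norms.L2Operator

namespace Literature.MathematicalPhysics.QuantumLattice

section General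

variable {n : Type*} [Fintype n] [DecidableEq n]

/-- Moving a matrix to the other side of the inner product: `⟪T_{Aᴴ} x, y⟫ = ⟪x, T_A y⟫`
(`toEuclideanLin Aᴴ` is the adjoint of `toEuclideanLin A`). [folklore] -/
theorem inner_toEuclideanLin_conjTranspose_left (A : Matrix n n ℂ) (x y : EuclideanSpace ℂ n) :
    ⟪toEuclideanLin Aᴴ x, y⟫_ℂ = ⟪x, toEuclideanLin A y⟫_ℂ := by
  rw [Matrix.toEuclideanLin_conjTranspose_eq_adjoint, LinearMap.adjoint_inner_left]

/-- The quadratic form of a positive semidefinite matrix is non-negative,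
`0 ≤ re ⟪x, T_M x⟫`. [folklore] -/
theorem re_inner_toEuclideanLin_nonneg_of_posSemidef {M : Matrix n n ℂ} (hM : M.PosSemidef)
    (x : EuclideanSpace ℂ n) : 0 ≤ RCLike.re ⟪x, toEuclideanLin M x⟫_ℂ := by
  have h := hM.dotProduct_mulVec_nonneg (WithLp.ofLp x)
  rw [EuclideanSpace.inner_eq_star_dotProduct, ofLp_toLpLin, toLin'_apply,
    dotProduct_comm]
  exact (Complex.nonneg_iff.mp h).1

/-- The least eigenvalue bounds the quadratic form from below: `(⨅ⱼ λⱼ) ‖x‖² ≤ re ⟪x, T_A x⟫`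
(variational principle, Reed–Simon IV Thm XIII.1). [folklore] -/
theorem iInf_eigenvalues_mul_norm_sq_le {A : Matrix n n ℂ} (hA : A.IsHermitian)
    (x : EuclideanSpace ℂ n) :
    (⨅ j, hA.eigenvalues j) * ‖x‖ ^ 2 ≤ RCLike.re ⟪x, toEuclideanLin A x⟫_ℂ := by
  have hbdd : BddBelow (Set.range hA.eigenvalues) := (Set.finite_range _).bddBelow
  refine mul_norm_sq_le_re_inner_of_mem_orthogonal_span hA (S := ∅)
    (fun i _ => ciInf_le hbdd i) ?_
  have h0 : Submodule.span ℂ (Set.range fun i : (∅ : Finset n) => hA.eigenvectorBasis i) = ⊥ := by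
    rw [Submodule.span_eq_bot]
    rintro _ ⟨i, rfl⟩
    exact absurd i.2 (Finset.notMem_empty _)
  rw [h0, Submodule.bot_orthogonal_eq_top]
  exact Submodule.mem_top

/-- An eigenvalue is a value of the quadratic form of any `τ`-close matrix up to `τ`:
`λᵢ(B) ≥ (⨅ⱼ λⱼ(A)) − τ` when `‖A − B‖ ≤ τ` (all eigenvalues of `B` are `≥ E₀(A) − τ`).
Weyl's perturbation theorem, Bhatia *Matrix Analysis* Cor. III.2.6. [folklore] -/
theorem iInf_eigenvalues_sub_le_eigenvalues {A B : Matrix n n ℂ} (hA : A.IsHermitian)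
    (hB : B.IsHermitian) {τ : ℝ} (hAB : ‖A - B‖ ≤ τ) (i : n) :
    (⨅ j, hA.eigenvalues j) - τ ≤ hB.eigenvalues i := by
  have h1 := re_inner_le_re_inner_add_of_norm_sub_le (𝕜 := ℂ) (A := A) (B := B) (t := τ)
    (by rwa [← Matrix.cstar_norm_def]) (hB.eigenvectorBasis i)
  have h2 := iInf_eigenvalues_mul_norm_sq_le hA (hB.eigenvectorBasis i)
  rw [← eigenvalues_eq_re_inner hB i] at h1
  rw [hB.eigenvectorBasis.orthonormal.1 i, one_pow, mul_one] at h1 h2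
  -- `h1 : λᵢ(B) ≤ re ⟪uᵢ, A uᵢ⟫ + τ` is the wrong direction; use the symmetric bound
  have h3 := re_inner_le_re_inner_add_of_norm_sub_le (𝕜 := ℂ) (A := B) (B := A) (t := τ)
    (by rwa [← Matrix.cstar_norm_def, norm_sub_rev]) (hB.eigenvectorBasis i)
  rw [← eigenvalues_eq_re_inner hB i, hB.eigenvectorBasis.orthonormal.1 i, one_pow, mul_one] at h3
  linarith

/-- For `U` unitary, `T_U` preserves inner products. [folklore] -/
theorem inner_toEuclideanLin_unitary {U : Matrix n n ℂ} (hU : U ∈ unitary (Matrix n n ℂ))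
    (x y : EuclideanSpace ℂ n) :
    ⟪toEuclideanLin U x, toEuclideanLin U y⟫_ℂ = ⟪x, y⟫_ℂ := by
  have h1 : star U * U = 1 := Unitary.star_mul_self_of_mem hU
  rw [← inner_toEuclideanLin_conjTranspose_left, ← LinearMap.comp_apply,
    ← Matrix.toLpLin_mul_same, ← star_eq_conjTranspose, h1, Matrix.toLpLin_one,
    LinearMap.id_apply]

/-- For `U` unitary, `T_U` is norm preserving. [folklore] -/
theorem norm_toEuclideanLin_unitary {U : Matrix n n ℂ} (hU : U ∈ unitary (Matrix n n ℂ))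
    (x : EuclideanSpace ℂ n) : ‖toEuclideanLin U x‖ = ‖x‖ := by
  rw [@norm_eq_sqrt_re_inner ℂ, inner_toEuclideanLin_unitary hU, ← @norm_eq_sqrt_re_inner ℂ]

/-- `T_U (T_{U⋆} y) = y` for `U` unitary. [folklore] -/
theorem toEuclideanLin_mul_star_apply {U : Matrix n n ℂ} (hU : U ∈ unitary (Matrix n n ℂ))
    (y : EuclideanSpace ℂ n) : toEuclideanLin U (toEuclideanLin (star U) y) = y := by
  rw [← LinearMap.comp_apply, ← Matrix.toLpLin_mul_same, Unitary.mul_star_self_of_mem hU,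
    Matrix.toLpLin_one, LinearMap.id_apply]

/-- `T_{U⋆} (T_U x) = x` for `U` unitary. [folklore] -/
theorem toEuclideanLin_star_mul_apply {U : Matrix n n ℂ} (hU : U ∈ unitary (Matrix n n ℂ))
    (x : EuclideanSpace ℂ n) : toEuclideanLin (star U) (toEuclideanLin U x) = x := by
  rw [← LinearMap.comp_apply, ← Matrix.toLpLin_mul_same, Unitary.star_mul_self_of_mem hU,
    Matrix.toLpLin_one, LinearMap.id_apply]

/-- The linear automorphism of `EuclideanSpace ℂ n` given by a unitary matrix. [folklore] -/
theorem exists_linearEquiv_of_mem_unitary {U : Matrix n n ℂ} (hU : U ∈ unitary (Matrix n n ℂ)) :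
    ∃ e : EuclideanSpace ℂ n ≃ₗ[ℂ] EuclideanSpace ℂ n,
      (∀ x, e x = toEuclideanLin U x) ∧ ∀ y, e.symm y = toEuclideanLin (star U) y :=
  ⟨LinearEquiv.ofLinear (toEuclideanLin U) (toEuclideanLin (star U))
      (LinearMap.ext (toEuclideanLin_mul_star_apply hU))
      (LinearMap.ext (toEuclideanLin_star_mul_apply hU)),
    fun _ => rfl, fun _ => rfl⟩

/-- The quadratic form is bounded by the L²-operator norm: `|re ⟪x, T_E x⟫| ≤ ‖E‖ ‖x‖²`
(restatement of `abs_re_inner_toEuclideanLin_le` with the matrix norm). [folklore] -/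
theorem abs_re_inner_toEuclideanLin_le' (E : Matrix n n ℂ) (x : EuclideanSpace ℂ n) :
    |RCLike.re ⟪x, toEuclideanLin E x⟫_ℂ| ≤ ‖E‖ * ‖x‖ ^ 2 := by
  rw [Matrix.cstar_norm_def]
  exact abs_re_inner_toEuclideanLin_le E x

end General

/-! ### The block-form step: analytic package at fixed coupling ⟹ cluster gap -/

section Block

variable {n : Type*} [Fintype n] [DecidableEq n]

/-- **MZ13 §7, spectral step.** Let `H₀ ≥ 0` with `m`-dimensional kernel `K` (`m ≥ 1`) and gap
form bound `γ‖x‖² ≤ ⟨x, H₀ x⟩` on `Kᗮ`; let `B` be Hermitian and `U` unitary with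
`U⋆ B U = H₀ + W + Δ + e·1`, where `⟨x, W x⟩ ≥ −β⟨x, H₀ x⟩` (`β ≤ 1`), `W` vanishes on `K`,
`Δ K ⊆ K` and `‖Δ‖ ≤ δ` with `4δ < (1 − β)γ`. Then `B` has exactly `m` eigenvalues in a window of
width `2δ` above its least eigenvalue and all others `≥ (1 − β)γ − 4δ` higher:
`B.HasClusterGap m (2δ) ((1 − β)γ − 4δ)`. This is the computation of MZ13 §7 (arXiv:1109.1588
p. 16): on `U K` the energy is within `‖Δ_s‖` of `E_s`, on `(U K)ᗮ` it is
`≥ E_s + (1 − cJ)γ − ‖Δ_s‖`, "the gap is bounded below by `(1 − cJ)γ − 2‖Δ_s‖`" (here in the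
`HasClusterGap` normal form, whose gap is measured from the top of the window).
[cite: MichalakisZwolakCMP2013, §7 (arXiv:1109.1588 pp. 15–16)] -/
theorem hasClusterGap_of_conj_decomposition {H₀ B U W Δ : Matrix n n ℂ} {e β δ γ : ℝ} {m : ℕ}
    (hH₀ : H₀.PosSemidef) (hB : B.IsHermitian) (hU : U ∈ unitary (Matrix n n ℂ))
    (hdec : star U * B * U = H₀ + W + Δ + (e : ℂ) • 1)
    (hm : 0 < m) (hK : finrank ℂ (LinearMap.ker (toEuclideanLin H₀)) = m)
    (hgap : ∀ x ∈ (LinearMap.ker (toEuclideanLin H₀))ᗮ,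
      γ * ‖x‖ ^ 2 ≤ RCLike.re ⟪x, toEuclideanLin H₀ x⟫_ℂ)
    (hW₁ : ∀ x : EuclideanSpace ℂ n,
      -(β * RCLike.re ⟪x, toEuclideanLin H₀ x⟫_ℂ) ≤ RCLike.re ⟪x, toEuclideanLin W x⟫_ℂ)
    (hW₂ : ∀ x : EuclideanSpace ℂ n, toEuclideanLin H₀ x = 0 → toEuclideanLin W x = 0)
    (hΔ₁ : ∀ x : EuclideanSpace ℂ n, toEuclideanLin H₀ x = 0 →
      toEuclideanLin H₀ (toEuclideanLin Δ x) = 0)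
    (hΔ₂ : ‖Δ‖ ≤ δ) (hδ : 0 ≤ δ) (hβ : β ≤ 1) (h4 : 4 * δ < (1 - β) * γ) :
    B.HasClusterGap m (2 * δ) ((1 - β) * γ - 4 * δ) := by
  set K : Submodule ℂ (EuclideanSpace ℂ n) := LinearMap.ker (toEuclideanLin H₀) with hKdef
  obtain ⟨eU, heU, heU'⟩ := exists_linearEquiv_of_mem_unitary hU
  set K' : Submodule ℂ (EuclideanSpace ℂ n) := K.map (eU : EuclideanSpace ℂ n →ₗ[ℂ] _)
    with hK'def
  -- the rotated identity `B (U x) = U ((H₀ + W + Δ) x + e x)`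
  have hUB : B * U = U * (H₀ + W + Δ + (e : ℂ) • 1) := by
    rw [← hdec, ← Matrix.mul_assoc, ← Matrix.mul_assoc, Unitary.mul_star_self_of_mem hU,
      Matrix.one_mul]
  have hBU : ∀ x : EuclideanSpace ℂ n, toEuclideanLin B (toEuclideanLin U x) =
      toEuclideanLin U (toEuclideanLin H₀ x + toEuclideanLin W x + toEuclideanLin Δ x +
        (e : ℂ) • x) := by
    intro x
    rw [← LinearMap.comp_apply, ← Matrix.toLpLin_mul_same, hUB, Matrix.toLpLin_mul_same,
      LinearMap.comp_apply]
    congr 1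
    simp only [map_add, LinearMap.add_apply, LinearEquiv.map_smul, LinearMap.smul_apply,
      Matrix.toLpLin_one, LinearMap.id_apply]
  -- the quadratic form of `B` on `U x`
  have hformU : ∀ x : EuclideanSpace ℂ n,
      RCLike.re ⟪toEuclideanLin U x, toEuclideanLin B (toEuclideanLin U x)⟫_ℂ =
        RCLike.re ⟪x, toEuclideanLin H₀ x⟫_ℂ + RCLike.re ⟪x, toEuclideanLin W x⟫_ℂ +
          RCLike.re ⟪x, toEuclideanLin Δ x⟫_ℂ + e * ‖x‖ ^ 2 := by
    intro x
    have h6 : (⟪x, x⟫_ℂ).re = ‖x‖ ^ 2 := by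
      rw [← RCLike.re_to_complex, ← norm_sq_eq_re_inner]
    rw [hBU, inner_toEuclideanLin_unitary hU, inner_add_right, inner_add_right, inner_add_right,
      inner_smul_right]
    simp only [map_add, RCLike.re_to_complex, Complex.re_ofReal_mul, h6]
  -- membership in `K'`
  have hmemK' : ∀ y, y ∈ K' ↔ toEuclideanLin H₀ (toEuclideanLin (star U) y) = 0 := by
    intro y
    rw [hK'def, Submodule.mem_map_equiv, heU', hKdef, LinearMap.mem_ker]
  have hUmemK' : ∀ x, x ∈ K → toEuclideanLin U x ∈ K' := by
    intro x hx
    rw [hmemK', toEuclideanLin_star_mul_apply hU]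
    exact hx
  -- dimension
  have hK' : finrank ℂ K' = m := by rw [hK'def, LinearEquiv.finrank_map_eq, hK]
  -- invariance of `K'` under `B`
  have hinv : ∀ y ∈ K', toEuclideanLin B y ∈ K' := by
    intro y hy
    have hx : toEuclideanLin H₀ (toEuclideanLin (star U) y) = 0 := (hmemK' y).1 hy
    set x := toEuclideanLin (star U) y with hxdef
    have hyx : y = toEuclideanLin U x := (toEuclideanLin_mul_star_apply hU y).symm
    rw [hyx, hBU x, hx, hW₂ x hx, zero_add, zero_add]
    refine hUmemK' _ (Submodule.add_mem _ ?_ (Submodule.smul_mem _ _ ?_))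
    · exact hΔ₁ x hx
    · exact hx
  -- forms on `K'`
  have hlow₁ : ∀ y ∈ K', (e - δ) * ‖y‖ ^ 2 ≤ RCLike.re ⟪y, toEuclideanLin B y⟫_ℂ := by
    intro y hy
    have hx : toEuclideanLin H₀ (toEuclideanLin (star U) y) = 0 := (hmemK' y).1 hy
    set x := toEuclideanLin (star U) y with hxdef
    have hyx : y = toEuclideanLin U x := (toEuclideanLin_mul_star_apply hU y).symm
    have hΔx := abs_re_inner_toEuclideanLin_le' Δ x
    have hnorm : ‖y‖ = ‖x‖ := by rw [hyx, norm_toEuclideanLin_unitary hU]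
    rw [hyx, hformU x, hx, hW₂ x hx, inner_zero_right, map_zero, ← hyx, hnorm]
    have := (abs_le.mp hΔx).1
    nlinarith [mul_le_mul_of_nonneg_right hΔ₂ (sq_nonneg ‖x‖)]
  have hlow₂ : ∀ y ∈ K', RCLike.re ⟪y, toEuclideanLin B y⟫_ℂ ≤ (e + δ) * ‖y‖ ^ 2 := by
    intro y hy
    have hx : toEuclideanLin H₀ (toEuclideanLin (star U) y) = 0 := (hmemK' y).1 hy
    set x := toEuclideanLin (star U) y with hxdef
    have hyx : y = toEuclideanLin U x := (toEuclideanLin_mul_star_apply hU y).symm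
    have hΔx := abs_re_inner_toEuclideanLin_le' Δ x
    have hnorm : ‖y‖ = ‖x‖ := by rw [hyx, norm_toEuclideanLin_unitary hU]
    rw [hyx, hformU x, hx, hW₂ x hx, inner_zero_right, map_zero, ← hyx, hnorm]
    have := (abs_le.mp hΔx).2
    nlinarith [mul_le_mul_of_nonneg_right hΔ₂ (sq_nonneg ‖x‖)]
  -- forms on `K'ᗮ`
  have hhigh : ∀ y ∈ K'ᗮ, (e + (1 - β) * γ - δ) * ‖y‖ ^ 2 ≤
      RCLike.re ⟪y, toEuclideanLin B y⟫_ℂ := by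
    intro y hy
    set x := toEuclideanLin (star U) y with hxdef
    have hyx : y = toEuclideanLin U x := (toEuclideanLin_mul_star_apply hU y).symm
    have hxK : x ∈ Kᗮ := by
      rw [Submodule.mem_orthogonal]
      intro k hk
      have h1 : ⟪toEuclideanLin U k, y⟫_ℂ = 0 :=
        Submodule.inner_right_of_mem_orthogonal (hUmemK' k hk) hy
      rwa [hyx, inner_toEuclideanLin_unitary hU] at h1
    have hgx := hgap x hxK
    have hWx := hW₁ x
    have hΔx := (abs_le.mp (abs_re_inner_toEuclideanLin_le' Δ x)).1
    have h0 := re_inner_toEuclideanLin_nonneg_of_posSemidef hH₀ x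
    have hnorm : ‖y‖ = ‖x‖ := by rw [hyx, norm_toEuclideanLin_unitary hU]
    rw [hyx, hformU x, ← hyx, hnorm]
    have hβ' : 0 ≤ 1 - β := by linarith
    nlinarith [mul_le_mul_of_nonneg_right hΔ₂ (sq_nonneg ‖x‖),
      mul_le_mul_of_nonneg_left hgx hβ']
  have h := hasClusterGap_of_invariant_forms' hB K' hinv hm hK' (E := e) (δ := δ)
    (g := (1 - β) * γ) hδ h4 hlow₁ hlow₂ hhigh
  exact h

end Block

/-! ### The bootstrap step: a cluster gap survives small perturbations -/

section Bootstrap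

variable {n : Type*} [Fintype n] [DecidableEq n]

/-- **Bootstrap step (MZ13 §7, continuity of the gap in `s`).** If `A` has `m ≥ 1` eigenvalues in
a window of width `w` above its ground energy and a gap `g` above the window, and `‖A − B‖ ≤ τ`
with `2τ < g`, then the Hermitian `B` has `m` eigenvalues in a window of width `ω ≤ w + 2τ` above
*its* ground energy and a gap `g − 2τ` above that window (Weyl: every eigenvalue moves by at
most `τ`, `sepCount_of_norm_sub_le`, and the ground energy of `B` is `≥ E₀(A) − τ`). This is the
finite-dimensional content of "a contradiction of the continuity of `γ_s` for finite `L`" in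
MZ13 §7 (arXiv:1109.1588 p. 16), used here forwards on a grid in `s`.
[cite: MichalakisZwolakCMP2013, §7 (arXiv:1109.1588 p. 16)] -/
theorem exists_hasClusterGap_of_norm_sub_le {A B : Matrix n n ℂ} (hB : B.IsHermitian) {m : ℕ}
    (hm : 0 < m) {w g τ : ℝ} (h : A.HasClusterGap m w g) (hAB : ‖A - B‖ ≤ τ)
    (h2 : 2 * τ < g) :
    ∃ ω : ℝ, ω ≤ w + 2 * τ ∧ B.HasClusterGap m ω (g - 2 * τ) := by
  obtain ⟨hA, hw, hg, hcount, hsep⟩ := h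
  set EA : ℝ := ⨅ j, hA.eigenvalues j with hEA
  obtain ⟨hcountB, hsepB⟩ := sepCount_of_norm_sub_le (𝕜 := ℂ) hA hB (t := τ) (e := EA + w)
    (g := g) (m := m) (by rwa [← Matrix.cstar_norm_def]) hcount hsep h2
  -- a clustered index of `B`; in particular `n` is nonempty
  have hne : ({i | hB.eigenvalues i ≤ EA + w + τ} : Finset n).Nonempty := by
    rw [← Finset.card_pos, hcountB]
    exact hm
  obtain ⟨i₀, hi₀⟩ := hne
  simp only [mem_filter, mem_univ, true_and] at hi₀
  haveI : Nonempty n := ⟨i₀⟩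
  set EB : ℝ := ⨅ j, hB.eigenvalues j with hEB
  have hbddB : BddBelow (Set.range hB.eigenvalues) := (Set.finite_range _).bddBelow
  have hEB₁ : EA - τ ≤ EB := le_ciInf fun i => iInf_eigenvalues_sub_le_eigenvalues hA hB hAB i
  have hEB₂ : EB ≤ EA + w + τ := (ciInf_le hbddB i₀).trans hi₀
  refine ⟨EA + w + τ - EB, by linarith, hB, by linarith, by linarith, ?_, fun i => ?_⟩
  · have hθ : EB + (EA + w + τ - EB) = EA + w + τ := by ring
    rw [hθ]
    exact hcountB
  · have hθ₁ : EB + (EA + w + τ - EB) = EA + w + τ := by ring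
    have hθ₂ : EA + w + τ + (g - 2 * τ) = EA + w + g - τ := by ring
    rw [hθ₁, hθ₂]
    exact hsepB i

end Bootstrap

/-! ### The final argument -/

section Final

variable {n : Type*} [Fintype n] [DecidableEq n]

omit [Fintype n] [DecidableEq n] in
/-- `H₀ + sV` is Hermitian for real `s`. [folklore] -/
theorem isHermitian_add_real_smul {H₀ V : Matrix n n ℂ} (hH₀ : H₀.IsHermitian)
    (hV : V.IsHermitian) (s : ℝ) : (H₀ + (s : ℂ) • V).IsHermitian := by
  have h1 : ((s : ℂ) • V).IsHermitian := by
    rw [IsHermitian, conjTranspose_smul, hV.eq]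
    simp
  exact hH₀.add h1

/-- `‖(H₀ + sV) − (H₀ + tV)‖ = |s − t| ‖V‖ ≤ τ` when `|s − t| ‖V‖ ≤ τ`. [folklore] -/
theorem norm_sub_real_smul_le {H₀ V : Matrix n n ℂ} {s t τ : ℝ} (h : |s - t| * ‖V‖ ≤ τ) :
    ‖(H₀ + (s : ℂ) • V) - (H₀ + (t : ℂ) • V)‖ ≤ τ := by
  rw [add_sub_add_left_eq_sub, ← sub_smul, norm_smul, ← Complex.ofReal_sub, Complex.norm_real,
    Real.norm_eq_abs]
  exact h

/-- A frustration-free gapped `H₀ ≥ 0` (kernel of dimension `m ≥ 1`, form gap `γ` on the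
orthogonal complement) has the cluster gap `HasClusterGap m 0 γ`. [folklore] -/
theorem hasClusterGap_of_ker_of_gap {H₀ : Matrix n n ℂ} (hH₀ : H₀.PosSemidef) {m : ℕ}
    (hm : 0 < m) (hK : finrank ℂ (LinearMap.ker (toEuclideanLin H₀)) = m) {γ : ℝ} (hγ : 0 < γ)
    (hgap : ∀ x ∈ (LinearMap.ker (toEuclideanLin H₀))ᗮ,
      γ * ‖x‖ ^ 2 ≤ RCLike.re ⟪x, toEuclideanLin H₀ x⟫_ℂ) :
    H₀.HasClusterGap m 0 γ := by
  set K : Submodule ℂ (EuclideanSpace ℂ n) := LinearMap.ker (toEuclideanLin H₀) with hKdef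
  have hinv : ∀ x ∈ K, toEuclideanLin H₀ x ∈ K := fun x hx => by
    rw [hKdef, LinearMap.mem_ker] at hx ⊢
    rw [hx, map_zero]
  have hlow₁ : ∀ x ∈ K, (0 : ℝ) * ‖x‖ ^ 2 ≤ RCLike.re ⟪x, toEuclideanLin H₀ x⟫_ℂ := fun x hx => by
    rw [hKdef, LinearMap.mem_ker] at hx
    rw [hx, inner_zero_right, map_zero, zero_mul]
  have hlow₂ : ∀ x ∈ K, RCLike.re ⟪x, toEuclideanLin H₀ x⟫_ℂ ≤ (0 : ℝ) * ‖x‖ ^ 2 := fun x hx => by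
    rw [hKdef, LinearMap.mem_ker] at hx
    rw [hx, inner_zero_right, map_zero, zero_mul]
  have h := hasClusterGap_of_invariant_forms hH₀.1 K hinv hm hK (e₁ := 0) (e₂ := 0) (e₃ := γ)
    le_rfl (by linarith) hlow₁ hlow₂ hgap
  simpa using h

/-- **The final argument of Michalakis–Zwolak (MZ13 §7, abstract form).** Let `H₀ ≥ 0` have an
`m`-dimensional kernel `K` (`m ≥ 1`) with the gap form bound `γ‖x‖² ≤ ⟨x, H₀ x⟩` on `Kᗮ`, and let
`V` be Hermitian. Assume the *analytic core*: for every `s ∈ [0, 1]` such that all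
`H₀ + tV`, `t ∈ [0, s]`, have `m` low-lying eigenvalues in a window of width `≤ ω₀` and a gap
`γ/2` above it, there are a unitary `U` and `W`, `Δ`, `e` with
`U⋆ (H₀ + sV) U = H₀ + W + Δ + e·1`, `⟨x, W x⟩ ≥ −β⟨x, H₀ x⟩`, `W = 0` on `K`, `Δ K ⊆ K`,
`‖Δ‖ ≤ δ` (this is what MZ13 Propositions 1–2 and Lemma 3 provide, with `β = cJ` and
`δ = ‖Δ_s‖`). If `β ≤ 1/3`, `48δ ≤ γ` and `2δ < ω₀`, then `H₀ + V` has exactly `m` eigenvalues in a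
window of width `2δ` above its ground energy, separated by a gap `≥ γ/2` from the rest of the
spectrum. MZ13 §7 (arXiv:1109.1588 pp. 15–16): "`γ_s ≥ (1 − cJ)γ − 2‖Δ_s‖ ≥ (20/39)γ > γ/2`, for
all `s ∈ [0, s₀]` … Hence, `s₀ = 1` and `γ(1) ≥ γ/2`"; here the maximal-`s₀`/continuity argument is
replaced by induction along the grid `s_k = k/N`, `‖V‖/N ≤ min(γ/24, (ω₀ − 2δ)/2)`, using the
bootstrap step `exists_hasClusterGap_of_norm_sub_le` between grid points.
[cite: MichalakisZwolakCMP2013, Thm. 1 and §7 (arXiv:1109.1588 pp. 6, 15–16)] -/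
theorem hasClusterGap_of_stabilityCore {H₀ V : Matrix n n ℂ} (hH₀ : H₀.PosSemidef)
    (hV : V.IsHermitian) {m : ℕ} (hm : 0 < m)
    (hK : finrank ℂ (LinearMap.ker (toEuclideanLin H₀)) = m) {γ β δ ω₀ : ℝ} (hγ : 0 < γ)
    (hgap : ∀ x ∈ (LinearMap.ker (toEuclideanLin H₀))ᗮ,
      γ * ‖x‖ ^ 2 ≤ RCLike.re ⟪x, toEuclideanLin H₀ x⟫_ℂ)
    (hβ : β ≤ 1 / 3) (hδ₀ : 0 ≤ δ) (hδ : 48 * δ ≤ γ) (hω₀ : 2 * δ < ω₀)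
    (hcore : ∀ s ∈ Set.Icc (0 : ℝ) 1,
      (∀ t ∈ Set.Icc (0 : ℝ) s, ∃ ω : ℝ, ω ≤ ω₀ ∧
        (H₀ + (t : ℂ) • V).HasClusterGap m ω (γ / 2)) →
      ∃ (U W Δ : Matrix n n ℂ) (e : ℝ), U ∈ unitary (Matrix n n ℂ) ∧
        star U * (H₀ + (s : ℂ) • V) * U = H₀ + W + Δ + (e : ℂ) • 1 ∧
        (∀ x : EuclideanSpace ℂ n,
          -(β * RCLike.re ⟪x, toEuclideanLin H₀ x⟫_ℂ) ≤ RCLike.re ⟪x, toEuclideanLin W x⟫_ℂ) ∧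
        (∀ x : EuclideanSpace ℂ n, toEuclideanLin H₀ x = 0 → toEuclideanLin W x = 0) ∧
        (∀ x : EuclideanSpace ℂ n, toEuclideanLin H₀ x = 0 →
          toEuclideanLin H₀ (toEuclideanLin Δ x) = 0) ∧
        ‖Δ‖ ≤ δ) :
    (H₀ + V).HasClusterGap m (2 * δ) (γ / 2) := by
  -- constants
  set g₁ : ℝ := (1 - β) * γ - 4 * δ with hg₁def
  have hg₁ : γ / 2 + γ / 12 ≤ g₁ := by
    rw [hg₁def]
    nlinarith
  have h4 : 4 * δ < (1 - β) * γ := by nlinarith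
  set τ₀ : ℝ := min (γ / 24) ((ω₀ - 2 * δ) / 2) with hτ₀def
  have hτ₀ : 0 < τ₀ := lt_min (by linarith) (by linarith)
  -- the grid size
  obtain ⟨N, hNpos, hN⟩ : ∃ N : ℕ, 0 < N ∧ ‖V‖ / τ₀ ≤ N :=
    ⟨⌈‖V‖ / τ₀⌉₊ + 1, Nat.succ_pos _,
      (Nat.le_ceil _).trans (by exact_mod_cast Nat.le_succ _)⟩
  have hNr : (0 : ℝ) < N := by exact_mod_cast hNpos
  set τ : ℝ := ‖V‖ / N with hτdef
  have hτ0 : 0 ≤ τ := div_nonneg (norm_nonneg _) hNr.le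
  have hττ₀ : τ ≤ τ₀ := by
    rw [hτdef, div_le_iff₀ hNr]
    have := (div_le_iff₀ hτ₀).mp hN
    linarith [mul_comm τ₀ (N : ℝ)]
  have hτ₁ : τ ≤ γ / 24 := hττ₀.trans (min_le_left _ _)
  have hτ₂ : τ ≤ (ω₀ - 2 * δ) / 2 := hττ₀.trans (min_le_right _ _)
  have hHs : ∀ s : ℝ, (H₀ + (s : ℂ) • V).IsHermitian :=
    fun s => isHermitian_add_real_smul hH₀.1 hV s
  -- the analytic package at `s` gives the cluster gap `(2δ, g₁)` at `s`
  have hstep : ∀ s ∈ Set.Icc (0 : ℝ) 1,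
      (∀ t ∈ Set.Icc (0 : ℝ) s, ∃ ω : ℝ, ω ≤ ω₀ ∧
        (H₀ + (t : ℂ) • V).HasClusterGap m ω (γ / 2)) →
      (H₀ + (s : ℂ) • V).HasClusterGap m (2 * δ) g₁ := by
    intro s hs hprev
    obtain ⟨U, W, Δ, e, hU, hdec, hW₁, hW₂, hΔ₁, hΔ₂⟩ := hcore s hs hprev
    exact hasClusterGap_of_conj_decomposition hH₀ (hHs s) hU hdec hm hK hgap hW₁ hW₂ hΔ₁ hΔ₂
      hδ₀ (by linarith) h4
  -- bootstrap from a grid point to the next interval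
  have hboot : ∀ s t : ℝ, (H₀ + (s : ℂ) • V).HasClusterGap m (2 * δ) g₁ → s ≤ t →
      t ≤ s + 1 / N → ∃ ω : ℝ, ω ≤ ω₀ ∧ (H₀ + (t : ℂ) • V).HasClusterGap m ω (γ / 2) := by
    intro s t hgs hst hts
    have hnorm : ‖(H₀ + (s : ℂ) • V) - (H₀ + (t : ℂ) • V)‖ ≤ τ := by
      refine norm_sub_real_smul_le ?_
      have h1 : |s - t| ≤ 1 / N := by
        rw [abs_sub_comm, abs_of_nonneg (by linarith)]
        linarith
      calc |s - t| * ‖V‖ ≤ 1 / N * ‖V‖ := mul_le_mul_of_nonneg_right h1 (norm_nonneg _)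
        _ = τ := by rw [hτdef]; ring
    obtain ⟨ω, hω, hgt⟩ :=
      exists_hasClusterGap_of_norm_sub_le (hHs t) hm hgs hnorm (by linarith)
    exact ⟨ω, by linarith, hgt.mono (half_pos hγ) (by linarith)⟩
  -- induction along the grid
  have hind : ∀ k : ℕ, k ≤ N → ∀ t ∈ Set.Icc (0 : ℝ) (k / N), ∃ ω : ℝ, ω ≤ ω₀ ∧
      (H₀ + (t : ℂ) • V).HasClusterGap m ω (γ / 2) := by
    intro k
    induction k with
    | zero =>
      intro _ t ht
      have ht0 : t = 0 := by
        rcases ht with ⟨h1, h2⟩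
        simp only [Nat.cast_zero, zero_div] at h2
        linarith
      subst ht0
      refine ⟨0, by linarith, ?_⟩
      have h0 := hasClusterGap_of_ker_of_gap hH₀ hm hK hγ hgap
      simpa using h0.mono (half_pos hγ) (half_le_self hγ.le)
    | succ k ih =>
      intro hk t ht
      by_cases htk : t ≤ k / N
      · exact ih (Nat.le_of_succ_le hk) t ⟨ht.1, htk⟩
      · have hkN : (k : ℝ) / N ≤ 1 := by
          rw [div_le_one hNr]
          exact_mod_cast Nat.le_of_succ_le hk
        have hk0 : (0 : ℝ) ≤ k / N := div_nonneg (Nat.cast_nonneg _) hNr.le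
        have hgs := hstep _ ⟨hk0, hkN⟩ (ih (Nat.le_of_succ_le hk))
        refine hboot _ t hgs (le_of_lt (not_le.mp htk)) ?_
        have h2 := ht.2
        push_cast at h2
        rw [add_div] at h2
        exact h2
  -- at `s = 1`
  have hall := hind N le_rfl
  rw [div_self hNr.ne'] at hall
  have hfin := hstep 1 ⟨zero_le_one, le_rfl⟩ hall
  simp only [Complex.ofReal_one, one_smul] at hfin
  exact hfin.mono (half_pos hγ) (by linarith)

end Final

end Literature.MathematicalPhysics.QuantumLattice
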